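import Summits.ABC.StewartYu.PadicG3ParVI
import HarnessLib

/-!
# The `p`-adic Gen-3 parameter record v2 (corrected family `…V`) — part VJ: the gain currency of the packages

Support file (plain theorems; no named facts). Continues `PadicG3ParVI`. The frame's k-step packages
(`G3Setup.IneqPackP`, p2) measure the Schwarz gain in powers of `ρ = p^m·√p` and the coefficient bound as
`BwP = p^{⌊L₀/(p−1)⌋}·ρ^{L₀}`; the record's budgets are in units of `G = θm·log p`. At the record's link
`θ₀ = ½` these agree: **`ρ = exp G`**, `ρ^k = exp(G·k)`, so `log BwP = ⌊L₀/(p−1)⌋·log p + L₀·G ≤ L₀·(G + 1)`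
(`log p ≤ p − 1`), inside the allowance `AYV ∋ L₀V·(G+2)`; and the package exponent dominates the record's
`zerosV`: **`zerosV s ν ≤ G·((2·(2^ν·XsV s) + 1)·(TV s + 1))`** (nodes `NS = 2^ν·XsV`, jets `tS = TV + 1`).

## References
* [Nesterenko2003] Yu. V. Nesterenko, LNM 1819 (2003) — (3.8), (4.25).
-/

noncomputable section

open Finset Real

namespace Summit.ABC.StewartYu

namespace PadicG3Par

variable {n : ℕ} (P : PadicG3Par n)

/-- at `θ₀ = ½`: **`p^m · √p = exp G`**. [folklore] -/
theorem rho_eq_exp_G (hθ : P.θ₀ = 1 / 2) : (P.p : ℝ) ^ P.m * Real.sqrt P.p = Real.exp P.G := by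
  have hp : (0 : ℝ) < P.p := by linarith [P.two_le_p]
  unfold G θm
  rw [hθ, add_mul, Real.exp_add, ← Real.log_pow, Real.exp_log (pow_pos hp _)]
  congr 1
  rw [Real.sqrt_eq_rpow, Real.rpow_def_of_pos hp]
  congr 1; ring

/-- at `θ₀ = ½`: `(p^m √p)^k = exp(G·k)`. [folklore] -/
theorem rho_pow_eq_exp (hθ : P.θ₀ = 1 / 2) (k : ℕ) : ((P.p : ℝ) ^ P.m * Real.sqrt P.p) ^ k = Real.exp (P.G * k) := by
  rw [P.rho_eq_exp_G hθ, ← Real.exp_nat_mul]; ring_nf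

/-- `⌊L₀V/(p−1)⌋·log p ≤ L₀V` (`log p ≤ p − 1`). [folklore] -/
theorem floor_div_mul_log_le : ((P.L0V / (P.p - 1) : ℕ) : ℝ) * Real.log P.p ≤ P.L0V := by
  have hp : (2 : ℝ) ≤ P.p := P.two_le_p
  have hlog : Real.log (P.p : ℝ) ≤ (P.p : ℝ) - 1 := Real.log_le_sub_one_of_pos (by linarith)
  have hlog0 := P.log_p_pos
  have h1 : ((P.L0V / (P.p - 1) : ℕ) : ℝ) * ((P.p : ℝ) - 1) ≤ P.L0V := by
    have h := Nat.div_mul_le_self P.L0V (P.p - 1)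
    have h' : (((P.L0V / (P.p - 1)) * (P.p - 1) : ℕ) : ℝ) ≤ P.L0V := by exact_mod_cast h
    have e : (((P.p - 1 : ℕ)) : ℝ) = (P.p : ℝ) - 1 := by
      rw [Nat.cast_sub (by have := P.hp; omega)]; push_cast; ring
    push_cast [Nat.cast_mul] at h'
    rw [e] at h'
    exact h'
  have h0 : (0 : ℝ) ≤ ((P.L0V / (P.p - 1) : ℕ) : ℝ) := by positivity
  nlinarith

/-- at `θ₀ = ½`: **`log(p^{⌊L₀V/(p−1)⌋}·(p^m√p)^{L₀V}) ≤ L₀V·(G + 1)`** — the sharp coefficient bound `BwP L₀V m` of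
`PadicG3PackClosedP` in the record's currency (inside `AYV`). [cite: Nesterenko2003, (3.8)] -/
theorem log_BwP_shape_le (hθ : P.θ₀ = 1 / 2) :
    Real.log ((P.p : ℝ) ^ (P.L0V / (P.p - 1)) * ((P.p : ℝ) ^ P.m * Real.sqrt P.p) ^ P.L0V) ≤ P.L0V * (P.G + 1) := by
  have hp : (0 : ℝ) < P.p := by linarith [P.two_le_p]
  rw [P.rho_pow_eq_exp hθ, Real.log_mul (by positivity) (Real.exp_pos _).ne', Real.log_exp, Real.log_pow]
  have h := P.floor_div_mul_log_le
  nlinarith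

/-- **`zerosV s ν ≤ G·((2·(2^ν·XsV s) + 1)·(TV s + 1))`** (the package's exponent `(2·NS+1)·tS` dominates the record's).
[cite: Nesterenko2003, (4.25)] -/
theorem zerosV_le_gain (s ν : ℕ) :
    P.zerosV s ν ≤ P.G * ((((2 * (2 ^ ν * P.XsV s) + 1) * (P.TV s + 1) : ℕ) : ℝ)) := by
  unfold zerosV
  have hG : 0 ≤ P.G := by linarith [P.eight_le_G]
  push_cast
  have h0 : (0 : ℝ) ≤ P.TV s + 1 := by positivity
  have e : (2 : ℝ) ^ (ν + 1) * P.XsV s = 2 * (2 ^ ν * P.XsV s) := by rw [pow_succ]; ring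
  rw [e]
  nlinarith [mul_nonneg hG h0]

/-- at `θ₀ = ½`: the Schwarz factor `(p^m√p)^{(2N+1)t} = exp(G·(2N+1)t) ≥ exp(zerosV s ν)`. [cite: Nesterenko2003, (4.25)] -/
theorem exp_zerosV_le_rho_pow (hθ : P.θ₀ = 1 / 2) (s ν : ℕ) :
    Real.exp (P.zerosV s ν) ≤ ((P.p : ℝ) ^ P.m * Real.sqrt P.p) ^ ((2 * (2 ^ ν * P.XsV s) + 1) * (P.TV s + 1)) := by
  rw [P.rho_pow_eq_exp hθ]
  exact Real.exp_le_exp.mpr (P.zerosV_le_gain s ν)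

/-- at `m = 0`: `8(n+1) ≤ θ₀ · log p` (the large-`p` regime). [folklore] -/
theorem cG_le_θ₀_log_of_m_zero (hm : P.m = 0) : cG * (n + 1) ≤ P.θ₀ * Real.log P.p := by
  have h := P.cG_mul_le_G
  have hG : P.G = P.θ₀ * Real.log P.p := by unfold G θm; rw [hm]; push_cast; ring
  linarith [hG.le, hG.ge]

/-- at `m = 0`, `θ₀ = ½`: **`16(n+1) ≤ log p`** (so `p ≥ e^{16(n+1)}`). [folklore] -/
theorem sixteen_mul_le_log_p (hm : P.m = 0) (hθ : P.θ₀ = 1 / 2) : 16 * ((n : ℝ) + 1) ≤ Real.log P.p := by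
  have h := P.cG_le_θ₀_log_of_m_zero hm
  rw [hθ] at h
  unfold cG at h
  linarith

end PadicG3Par

end Summit.ABC.StewartYu
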